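import Literature.AnabelianGeometry.SemiGraphs.PSCSeparatingCoveringsTwoComponentUnmarked
import HarnessLib

/-!
# [CombGC] Prop. 1.2, proof p. 9: verticial separating coverings and verticial commensurable terminality at IRREDUCIBLE MULTI-NODAL data

Mochizuki, *A combinatorial version of the Grothendieck conjecture*, Tohoku Math. J. **59** (2007)
[CombGC], PROOF of Proposition 1.2, author's manuscript p. 9 (separating coverings, verticial case; typed
LEVEL-WISE as `PSCDatum.VerticialSeparatingCoverings`, row P12-L01-V, instance form of FACT-LIST row
F-2826) and Proposition 1.2 (ii) p. 8 for VERTICIAL subgroups (verticial part of the first clause of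
F-0438) [cite: MochizukiCombGC2007, Prop 1.2 proof p.9] [cite: MochizukiCombGC2007, Prop 1.2(ii) p.8].

PROOF-ONLY file (abc-iut-f-164 gen 5; WAKE row «IRRNODAL-CT» of the lineage, verticial half) at the data
of IRREDUCIBLE `k`-NODAL SHAPE (the stratum `Δ_irr` and its self-intersections): ONE vertex carrying `k`
loops and all `r ≥ 1` cusps, over a pro-`Σ` completion `ι : Γ_{g,r} → Π` of the smoothing; vertex group
`Π_v = cl ι⟨b_m, a_m b_m a_m⁻¹ (m < k), a_i, b_i (i ≥ k), c_j⟩` (the surface cut open along the `k`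
non-separating loops `b_m`, the `a_m` being the stable letters) — an HNN-base, NOT the closure of a free
factor of `Γ_{g,r}`.  In the `c₀`-eliminating free basis `b₀` this is `cl ι⟨b₀(S) ∪ E⟩` with `S` = all
letters except the stable letters `a_m` (`m < k`) and `E = {a_m b_m a_m⁻¹ : m < k}` — words in the
letters `a_m ∉ S` and `b_m ∈ S`, the latter killed by the indicator character `Ψ` of the letter `a_k`
(if `k < g`) or `c_1` (if `r ≥ 2`).  So the CUT-OFF CHARACTER TWIST
(`PSCSeparatingCoveringsCutoffVertex.lean`) separates any two distinct level vertices (there is one vertex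
of `G`, so every pair of level vertices is a same-vertex pair), at the level `V` itself.  Hypothesis
`k < g ∨ 2 ≤ r`: for `k = g`, `r = 1` (normalisation of genus `0` with `2k + 1` points) every letter of `S`
is one of the `b_m`, no cut-off character exists, and indeed separating coverings at `V' = V` can fail
there (a level component that is a sphere whose node branches all lead to one other component admits no
cover trivial over the latter and nontrivial over itself).

* `verticialSeparatingCoverings_of_irreducibleMultiNodal'` — F-2826 / P12-L01-V (`V' := V`);
* `verticialRows_of_irreducibleMultiNodal` — with Prop. 1.2 (ii) for verticial subgroups
  (w5-d183's `commensurator_vertGp_eq_of_separating`); origin level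
  `irreducibleMultiNodalOrigin_verticialRows` (gen 4's origin hypothesis plus `1 ≤ r`, `k < g ∨ 2 ≤ r`).

Instance forms at data of the shape of genuine irreducible nodal curves; consistency evidence for the
typed rows, not the printed theorems for all pointed stable curves.  0 definitions; nothing here takes a
side on [IUTchIII] Cor. 3.12.
-/

noncomputable section

namespace Literature.AnabelianGeometry.SemiGraphs

open scoped Pointwise
open Literature.GroupTheory.CombinatorialGroupTheory
open Literature.GroupTheory.CombinatorialGroupTheory.PuncturedSurfaceGroup
open Literature.GroupTheory.CombinatorialGroupTheory.FreeFactorFibredTwist (lift_apply_basis)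
open SemiGraphOfAnabelioids (IsProSigmaCompletion)
open SemiGraphOfAnabelioids.IsProSigmaCompletion (cutoff_exists_open_separating_sameVertex)

universe u

namespace PSCDatum

/-! ### The cut-open vertex group in the `c₀`-eliminating free basis -/

section Discrete

variable {g r' k : ℕ} (hk : k ≤ g)
  {b₀ : FreeGroupBasis ((Fin g × Bool) ⊕ Fin r') (PuncturedSurfaceGroup g (r' + 1))}
  (ha : ∀ i, b₀ (Sum.inl (i, false)) = a i) (hb : ∀ i, b₀ (Sum.inl (i, true)) = b i)
  (hc : ∀ j : Fin r', b₀ (Sum.inr j) = c (Fin.succ j))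

/-- The empty handle window: `∏_{g ≤ i < g} [a_i,b_i] = 1`. [cite: MochizukiSemiAnbd2006, Ex. 2.10 p.31] -/
theorem comm_prod_ge_self_eq_one {g r : ℕ} :
    ((List.finRange g).map fun i : Fin g => if g ≤ (i : ℕ) then
      a (r := r) i * b i * (a i)⁻¹ * (b i)⁻¹ else 1).prod = 1 := by
  refine List.prod_eq_one fun y hy => ?_
  obtain ⟨i, -, rfl⟩ := List.mem_map.mp hy
  exact if_neg (Nat.not_le.mpr i.2)

/-- **`c₀` from the relation**: `c_0 ∈ H` as soon as `H` contains every commutator `[a_i, b_i]` and every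
`c_j`, `j ≥ 1` (`(∏_i [a_i,b_i]) c_0 (c_1⋯c_{r'}) = 1`). [cite: MochizukiSemiAnbd2006, Ex. 2.10 p.31] -/
theorem c_zero_mem_of_comm_mem {g r' : ℕ} (H : Subgroup (PuncturedSurfaceGroup g (r' + 1)))
    (hcomm : ∀ i : Fin g, a (r := r' + 1) i * b i * (a i)⁻¹ * (b i)⁻¹ ∈ H)
    (hcusp : ∀ j : Fin (r' + 1), 1 ≤ (j : ℕ) → c (g := g) j ∈ H) :
    c (g := g) (⟨0, Nat.succ_pos r'⟩ : Fin (r' + 1)) ∈ H := by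
  classical
  have h := comm_split_mul_cusp_split_eq_one (g := g) (r := r' + 1) g 0
  rw [comm_prod_ge_self_eq_one, mul_one, cusp_prod_lt_zero_eq_one, one_mul,
    prod_map_finRange_ite_le_peel (r' + 1) 0 (Nat.succ_pos r') (fun j => c (g := g) j)] at h
  -- `h : X * (c_0 * C₁) = 1`
  have e : c (g := g) (⟨0, Nat.succ_pos r'⟩ : Fin (r' + 1)) =
      (((List.finRange g).map fun i : Fin g => if (i : ℕ) < g then
          a (r := r' + 1) i * b i * (a i)⁻¹ * (b i)⁻¹ else 1).prod)⁻¹ *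
        (((List.finRange (r' + 1)).map fun j : Fin (r' + 1) =>
          if 0 + 1 ≤ (j : ℕ) then c (g := g) j else 1).prod)⁻¹ :=
    eq_mul_inv_of_mul_eq (eq_inv_of_mul_eq_one_right h)
  rw [e]
  exact H.mul_mem (H.inv_mem (prod_map_finRange_ite_mem _ _ _ _ fun i _ => hcomm i))
    (H.inv_mem (prod_map_finRange_ite_mem _ _ _ _ fun j hj => hcusp j (by omega)))

include ha hb hc in
/-- **The cut-open vertex group in the `c₀`-eliminating basis**:
`⟨b_m, a_m b_m a_m⁻¹ (m < k), a_i, b_i (i ≥ k), c_j⟩ = ⟨b₀(S) ∪ E⟩` with `S` = all letters but the stable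
letters `a_m`, `m < k`, and `E = {a_m b_m a_m⁻¹ : m < k}` (`c_0` from the relation: `[a_m, b_m] =
(a_m b_m a_m⁻¹) · b_m⁻¹`). [cite: MochizukiSemiAnbd2006, Ex. 2.10 p.31] -/
theorem closure_multiNodalVertex_eq :
    Subgroup.closure {x : PuncturedSurfaceGroup g (r' + 1) |
        (∃ m : Fin k, x = b (Fin.castLE hk m) ∨ x = a (Fin.castLE hk m) * b (Fin.castLE hk m) *
          (a (Fin.castLE hk m))⁻¹) ∨
        (∃ i : Fin g, k ≤ (i : ℕ) ∧ (x = a i ∨ x = b i)) ∨ ∃ j : Fin (r' + 1), x = c j} =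
      Subgroup.closure (b₀ '' {x | Sum.elim (fun p : Fin g × Bool => k ≤ (p.1 : ℕ) ∨ p.2 = true)
        (fun _ : Fin r' => True) x} ∪
        {x | ∃ m : Fin k, x = a (Fin.castLE hk m) * b (Fin.castLE hk m) * (a (Fin.castLE hk m))⁻¹}) := by
  classical
  apply le_antisymm
  · rw [Subgroup.closure_le]
    rintro x (⟨m, rfl | rfl⟩ | ⟨i, hi, rfl | rfl⟩ | ⟨j, rfl⟩)
    · rw [← hb]
      exact Subgroup.subset_closure (Or.inl ⟨Sum.inl (Fin.castLE hk m, true), Or.inr rfl, rfl⟩)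
    · exact Subgroup.subset_closure (Or.inr ⟨m, rfl⟩)
    · rw [← ha]
      exact Subgroup.subset_closure (Or.inl ⟨Sum.inl (i, false), Or.inl hi, rfl⟩)
    · rw [← hb]
      exact Subgroup.subset_closure (Or.inl ⟨Sum.inl (i, true), Or.inr rfl, rfl⟩)
    · by_cases hj0 : (j : ℕ) = 0
      · have : j = ⟨0, Nat.succ_pos r'⟩ := Fin.ext hj0
        rw [this]
        refine c_zero_mem_of_comm_mem _ (fun i => ?_) (fun j' hj' => ?_)
        · by_cases hik : (i : ℕ) < k
          · -- `[a_i, b_i] = (a_i b_i a_i⁻¹) · b_i⁻¹` with `i = castLE ⟨i, hik⟩`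
            have ei : Fin.castLE hk ⟨i, hik⟩ = i := Fin.ext rfl
            refine Subgroup.mul_mem _ ?_ (Subgroup.inv_mem _ ?_)
            · rw [← ei]
              exact Subgroup.subset_closure (Or.inr ⟨⟨i, hik⟩, rfl⟩)
            · rw [← hb]
              exact Subgroup.subset_closure (Or.inl ⟨Sum.inl (i, true), Or.inr rfl, rfl⟩)
          · refine Subgroup.mul_mem _ (Subgroup.mul_mem _ (Subgroup.mul_mem _ ?_ ?_)
              (Subgroup.inv_mem _ ?_)) (Subgroup.inv_mem _ ?_)
            · exact Subgroup.subset_closure (Or.inl ⟨Sum.inl (i, false), Or.inl (Nat.le_of_not_lt hik), ha i⟩)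
            · exact Subgroup.subset_closure (Or.inl ⟨Sum.inl (i, true), Or.inr rfl, hb i⟩)
            · exact Subgroup.subset_closure (Or.inl ⟨Sum.inl (i, false), Or.inl (Nat.le_of_not_lt hik), ha i⟩)
            · exact Subgroup.subset_closure (Or.inl ⟨Sum.inl (i, true), Or.inr rfl, hb i⟩)
        · have hj0' : j' ≠ 0 := by
            rintro rfl
            exact absurd hj' (by simp)
          have e1 : b₀ (Sum.inr (j'.pred hj0')) = c j' := by rw [hc, Fin.succ_pred]
          rw [← e1]
          exact Subgroup.subset_closure (Or.inl ⟨Sum.inr (j'.pred hj0'), trivial, rfl⟩)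
      · have hj0' : j ≠ 0 := fun h => hj0 (by rw [h]; rfl)
        have e1 : b₀ (Sum.inr (j.pred hj0')) = c j := by rw [hc, Fin.succ_pred]
        rw [← e1]
        exact Subgroup.subset_closure (Or.inl ⟨Sum.inr (j.pred hj0'), trivial, rfl⟩)
  · rw [Subgroup.closure_le]
    rintro y (⟨x, hx, rfl⟩ | ⟨m, rfl⟩)
    · rcases x with ⟨i, _ | _⟩ | j
      · -- `a_i`, `k ≤ i`
        rcases hx with hx | hx
        · rw [ha]; exact Subgroup.subset_closure (Or.inr (Or.inl ⟨i, hx, Or.inl rfl⟩))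
        · exact absurd hx (by simp)
      · -- `b_i`
        rw [hb]
        by_cases hik : (i : ℕ) < k
        · have ei : Fin.castLE hk ⟨i, hik⟩ = i := Fin.ext rfl
          refine Subgroup.subset_closure (Or.inl ⟨⟨i, hik⟩, Or.inl ?_⟩)
          rw [ei]
        · exact Subgroup.subset_closure (Or.inr (Or.inl ⟨i, Nat.le_of_not_lt hik, Or.inr rfl⟩))
      · rw [hc]
        exact Subgroup.subset_closure (Or.inr (Or.inr ⟨Fin.succ j, rfl⟩))
    · exact Subgroup.subset_closure (Or.inl ⟨m, Or.inr rfl⟩)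

end Discrete

/-! ### F-2826 at irreducible multi-nodal data -/

section Datum

variable {P : Type*} [Group P] [TopologicalSpace P] [IsTopologicalGroup P]
variable [CompactSpace P] [TotallyDisconnectedSpace P] {Sigma : Set ℕ} {g r : ℕ}

/-- **F-2826 / row P12-L01-V (`VerticialSeparatingCoverings`, `V' := V`) at EVERY datum of irreducible
`k`-nodal shape** (one vertex with `k` loops and all `r ≥ 1` cusps; `k < g ∨ 2 ≤ r`): any two distinct
level vertices are separated by the cut-off character twist at the HNN-base vertex group
`Π_v = cl ι⟨b₀(S) ∪ {a_m b_m a_m⁻¹}⟩`. [cite: MochizukiCombGC2007, Prop 1.2 proof p.9] -/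
theorem verticialSeparatingCoverings_of_irreducibleMultiNodal' (hne : Sigma.Nonempty)
    (hprime : ∀ p ∈ Sigma, p.Prime) (ι : PuncturedSurfaceGroup g r →* P)
    (hι : IsProSigmaCompletion Sigma ι) (G : PSCDatum P) {k : ℕ} (hk : k ≤ g) (hr : 1 ≤ r)
    (hkr : k < g ∨ 2 ≤ r) (v₀ : G.graph.V) (hV : ∀ w, w = v₀)
    (hV₀ : G.vertGp v₀ = ((Subgroup.closure {x : PuncturedSurfaceGroup g r |
        (∃ m : Fin k, x = PuncturedSurfaceGroup.b (Fin.castLE hk m) ∨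
          x = PuncturedSurfaceGroup.a (Fin.castLE hk m) * PuncturedSurfaceGroup.b (Fin.castLE hk m) *
            (PuncturedSurfaceGroup.a (Fin.castLE hk m))⁻¹) ∨
        (∃ i : Fin g, k ≤ (i : ℕ) ∧ (x = PuncturedSurfaceGroup.a i ∨ x = PuncturedSurfaceGroup.b i)) ∨
        ∃ j : Fin r, x = PuncturedSurfaceGroup.c j}).map ι).topologicalClosure) :
    G.VerticialSeparatingCoverings := by
  classical
  obtain ⟨r', rfl⟩ : ∃ r', r = r' + 1 := ⟨r - 1, by omega⟩
  obtain ⟨ℓ, hℓS⟩ := hne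
  have hℓ : ℓ.Prime := hprime ℓ hℓS
  obtain ⟨b₀, ha, hb, hc⟩ := exists_freeGroupBasis_elim_zero g r'
  set S : Set ((Fin g × Bool) ⊕ Fin r') :=
    {x | Sum.elim (fun p : Fin g × Bool => k ≤ (p.1 : ℕ) ∨ p.2 = true) (fun _ : Fin r' => True) x} with hS
  set E : Set (PuncturedSurfaceGroup g (r' + 1)) :=
    {x | ∃ m : Fin k, x = a (Fin.castLE hk m) * b (Fin.castLE hk m) * (a (Fin.castLE hk m))⁻¹} with hEdef
  have hA_eq := closure_multiNodalVertex_eq (r' := r') hk ha hb hc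
  -- the indicator character of `a_k` (if `k < g`) or of `c_1` (if `r ≥ 2`): a letter of `S`, not a `b_m`
  have hi₀ : ∃ i₀ : (Fin g × Bool) ⊕ Fin r', i₀ ∈ S ∧ ∀ i : Fin g, i₀ ≠ Sum.inl (i, true) := by
    rcases hkr with h | h
    · exact ⟨Sum.inl (⟨k, h⟩, false), Or.inl le_rfl, fun i hi => by cases hi⟩
    · exact ⟨Sum.inr ⟨0, by omega⟩, trivial, fun i hi => by cases hi⟩
  obtain ⟨i₀, hi₀S, hi₀b⟩ := hi₀
  let Ψ : PuncturedSurfaceGroup g (r' + 1) →* Multiplicative ℤ :=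
    b₀.lift fun x => if x = i₀ then Multiplicative.ofAdd 1 else 1
  have hΨ : ∀ x, Ψ (b₀ x) = if x = i₀ then Multiplicative.ofAdd 1 else 1 :=
    fun x => lift_apply_basis b₀ _ x
  have hΨ_out : ∀ x, x ∉ S → Ψ (b₀ x) = 1 := fun x hx => by
    have hxi : x ≠ i₀ := by
      rintro rfl
      exact hx hi₀S
    rw [hΨ, if_neg hxi]
  have hΨ_i₀ : Ψ (b₀ i₀) ≠ 1 := by
    rw [hΨ, if_pos rfl]
    exact fun h => one_ne_zero (Multiplicative.ofAdd.injective (h.trans ofAdd_zero.symm))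
  -- `E` consists of words in `a_m ∉ S` and `b_m ∈ S ∩ Ker Ψ`
  have hE : E ⊆ Subgroup.closure (b₀ '' {x | x ∈ S → Ψ (b₀ x) = 1}) := by
    rintro _ ⟨m, rfl⟩
    have haK : a (r := r' + 1) (Fin.castLE hk m) ∈ Subgroup.closure (b₀ '' {x | x ∈ S → Ψ (b₀ x) = 1}) := by
      refine Subgroup.subset_closure ⟨Sum.inl (Fin.castLE hk m, false), fun hx => ?_, ha _⟩
      rcases hx with hx | hx
      · exact absurd m.2 (by simp only [Fin.val_castLE] at hx; omega)
      · exact absurd hx (by simp)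
    have hbK : b (r := r' + 1) (Fin.castLE hk m) ∈ Subgroup.closure (b₀ '' {x | x ∈ S → Ψ (b₀ x) = 1}) := by
      refine Subgroup.subset_closure ⟨Sum.inl (Fin.castLE hk m, true), fun _ => ?_, hb _⟩
      rw [hΨ, if_neg (fun h => hi₀b (Fin.castLE hk m) h.symm)]
    exact Subgroup.mul_mem _ (Subgroup.mul_mem _ haK hbK) (Subgroup.inv_mem _ haK)
  have hV₀' : G.vertGp v₀ = ((Subgroup.closure (b₀ '' S ∪ E)).map ι).topologicalClosure := by
    rw [hV₀, hA_eq]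
  refine G.verticialSeparatingCoverings_of_sameVertex_of_crossVertex ?_ ?_
  · intro V hVn hVo v γ₁ γ₂ hne
    haveI := hVn
    obtain rfl := hV v
    exact cutoff_exists_open_separating_sameVertex hι b₀ S Ψ hΨ_out E hE _ rfl hi₀S hΨ_i₀ hℓ hℓS _ hV₀'
      V hVo γ₁ γ₂ hne
  · intro V _ _ w₁ w₂ γ₁ γ₂ hw
    exact absurd ((hV w₁).trans (hV w₂).symm) hw

/-- **F-2826 with its P12-L03 consequence at every irreducible multi-nodal datum**: the verticial
separating coverings, Prop. 1.2 (i) verticial case, and Prop. 1.2 (ii) for VERTICIAL subgroups ("the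
`A_i` are commensurably terminal in `Π_G`"). [cite: MochizukiCombGC2007, Prop 1.2(ii) p.8] -/
theorem verticialRows_of_irreducibleMultiNodal (hne : Sigma.Nonempty)
    (hprime : ∀ p ∈ Sigma, p.Prime) (ι : PuncturedSurfaceGroup g r →* P)
    (hι : IsProSigmaCompletion Sigma ι) (G : PSCDatum P) {k : ℕ} (hk : k ≤ g) (hr : 1 ≤ r)
    (hkr : k < g ∨ 2 ≤ r) (v₀ : G.graph.V) (hV : ∀ w, w = v₀)
    (hV₀ : G.vertGp v₀ = ((Subgroup.closure {x : PuncturedSurfaceGroup g r |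
        (∃ m : Fin k, x = PuncturedSurfaceGroup.b (Fin.castLE hk m) ∨
          x = PuncturedSurfaceGroup.a (Fin.castLE hk m) * PuncturedSurfaceGroup.b (Fin.castLE hk m) *
            (PuncturedSurfaceGroup.a (Fin.castLE hk m))⁻¹) ∨
        (∃ i : Fin g, k ≤ (i : ℕ) ∧ (x = PuncturedSurfaceGroup.a i ∨ x = PuncturedSurfaceGroup.b i)) ∨
        ∃ j : Fin r, x = PuncturedSurfaceGroup.c j}).map ι).topologicalClosure) :
    G.VerticialSeparatingCoverings ∧ G.VerticialOpenInterDeterminesVertex ∧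
      ∀ A : Subgroup P, G.IsVerticial A → Subgroup.Commensurable.commensurator A = A := by
  have hsep := G.verticialSeparatingCoverings_of_irreducibleMultiNodal' hne hprime ι hι hk hr hkr v₀ hV hV₀
  refine ⟨hsep, G.verticialOpenInterDeterminesVertex_of_separating hsep, ?_⟩
  rintro A ⟨v, γ, rfl⟩
  exact G.commensurator_vertGp_eq_of_separating hsep v γ

/-- The one-nodal vertex set (`k = 1`, as displayed in `PSCIrreducibleNodalShape.lean`) is the `k = 1` case
of the multi-nodal one. [cite: MochizukiSemiAnbd2006, Ex. 2.10 p.31] -/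
theorem irreducibleNodalVertexSet_eq (hg : 1 ≤ g) :
    {x : PuncturedSurfaceGroup g r |
        x = PuncturedSurfaceGroup.b ⟨0, hg⟩ ∨
        x = PuncturedSurfaceGroup.a ⟨0, hg⟩ * PuncturedSurfaceGroup.b ⟨0, hg⟩ * (PuncturedSurfaceGroup.a ⟨0, hg⟩)⁻¹ ∨
        (∃ i : Fin g, 1 ≤ (i : ℕ) ∧ (x = PuncturedSurfaceGroup.a i ∨ x = PuncturedSurfaceGroup.b i)) ∨
        ∃ j : Fin r, x = PuncturedSurfaceGroup.c j} =
      {x : PuncturedSurfaceGroup g r |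
        (∃ m : Fin 1, x = PuncturedSurfaceGroup.b (Fin.castLE hg m) ∨
          x = PuncturedSurfaceGroup.a (Fin.castLE hg m) * PuncturedSurfaceGroup.b (Fin.castLE hg m) *
            (PuncturedSurfaceGroup.a (Fin.castLE hg m))⁻¹) ∨
        (∃ i : Fin g, 1 ≤ (i : ℕ) ∧ (x = PuncturedSurfaceGroup.a i ∨ x = PuncturedSurfaceGroup.b i)) ∨
        ∃ j : Fin r, x = PuncturedSurfaceGroup.c j} := by
  have e0 : Fin.castLE hg (0 : Fin 1) = ⟨0, hg⟩ := Fin.ext rfl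
  ext x
  constructor
  · rintro (h | h | h | h)
    · exact Or.inl ⟨0, Or.inl (by rw [e0]; exact h)⟩
    · exact Or.inl ⟨0, Or.inr (by rw [e0]; exact h)⟩
    · exact Or.inr (Or.inl h)
    · exact Or.inr (Or.inr h)
  · rintro (⟨m, h | h⟩ | h | h)
    · rw [Subsingleton.elim m 0, e0] at h
      exact Or.inl h
    · rw [Subsingleton.elim m 0, e0] at h
      exact Or.inr (Or.inl h)
    · exact Or.inr (Or.inr (Or.inl h))
    · exact Or.inr (Or.inr (Or.inr h))

/-- **F-2826, Prop. 1.2 (i) verticial, Prop. 1.2 (ii) verticial at EVERY irreducible ONE-nodal datum**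
(`g ≥ 1`, `r ≥ 1`, `2 ≤ g ∨ 2 ≤ r`; the vertex group displayed as in `PSCIrreducibleNodalShape.lean`).
[cite: MochizukiCombGC2007, Prop 1.2(ii) p.8] -/
theorem verticialRows_of_irreducibleNodal (hne : Sigma.Nonempty)
    (hprime : ∀ p ∈ Sigma, p.Prime) (ι : PuncturedSurfaceGroup g r →* P)
    (hι : IsProSigmaCompletion Sigma ι) (G : PSCDatum P) (hg : 1 ≤ g) (hr : 1 ≤ r)
    (hgr : 2 ≤ g ∨ 2 ≤ r) (v₀ : G.graph.V) (hV : ∀ w, w = v₀)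
    (hV₀ : G.vertGp v₀ = ((Subgroup.closure {x : PuncturedSurfaceGroup g r |
        x = PuncturedSurfaceGroup.b ⟨0, hg⟩ ∨
        x = PuncturedSurfaceGroup.a ⟨0, hg⟩ * PuncturedSurfaceGroup.b ⟨0, hg⟩ * (PuncturedSurfaceGroup.a ⟨0, hg⟩)⁻¹ ∨
        (∃ i : Fin g, 1 ≤ (i : ℕ) ∧ (x = PuncturedSurfaceGroup.a i ∨ x = PuncturedSurfaceGroup.b i)) ∨
        ∃ j : Fin r, x = PuncturedSurfaceGroup.c j}).map ι).topologicalClosure) :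
    G.VerticialSeparatingCoverings ∧ G.VerticialOpenInterDeterminesVertex ∧
      ∀ A : Subgroup P, G.IsVerticial A → Subgroup.Commensurable.commensurator A = A := by
  rw [irreducibleNodalVertexSet_eq hg] at hV₀
  exact G.verticialRows_of_irreducibleMultiNodal hne hprime ι hι hg hr
    (hgr.imp_left (fun h => h)) v₀ hV hV₀

end Datum

/-! ### Origin level -/

/-- **F-2826, Prop. 1.2 (i) verticial and Prop. 1.2 (ii) verticial at every origin whose data are of
irreducible `k`-nodal shape with `r ≥ 1` marked points and `k < g ∨ 2 ≤ r`** (gen 4's origin hypothesis of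
`PSCUnrVerticialSeparatingCoveringsIrreducibleMultiNodal.lean` with these two clauses added; profinite `Π`
in `Type`). [cite: MochizukiCombGC2007, Prop 1.2(ii) p.8] -/
theorem irreducibleMultiNodalOrigin_verticialRows (Ω : PSCOrigin.{0})
    (hΩ : ∀ ⦃Q : Type⦄ [Group Q] [TopologicalSpace Q] [IsTopologicalGroup Q] (G : PSCDatum Q),
      Ω.IsOfPSCType G → CompactSpace Q ∧ T2Space Q ∧ TotallyDisconnectedSpace Q ∧
        ∃ (S : Set ℕ) (g r k : ℕ) (hk : k ≤ g) (ι : PuncturedSurfaceGroup g r →* Q)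
          (e : G.graph.C ≃ Fin r) (v₀ : G.graph.V) (eN : G.graph.N ≃ Fin k),
          S.Nonempty ∧ (∀ p ∈ S, p.Prime) ∧ IsProSigmaCompletion S ι ∧
          PuncturedSurfaceGroup.IsHyperbolicType g r ∧ 1 ≤ r ∧ (k < g ∨ 2 ≤ r) ∧
          (∀ c, G.cuspGp c =
            ((PuncturedSurfaceGroup.cuspInertia (g := g) (e c)).map ι).topologicalClosure) ∧
          (∀ w, w = v₀) ∧
          (∀ m, G.nodeGp m = ((Subgroup.zpowers
            (PuncturedSurfaceGroup.b (r := r) (Fin.castLE hk (eN m)))).map ι).topologicalClosure) ∧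
          G.vertGp v₀ = ((Subgroup.closure {x : PuncturedSurfaceGroup g r |
            (∃ m : Fin k, x = PuncturedSurfaceGroup.b (Fin.castLE hk m) ∨
              x = PuncturedSurfaceGroup.a (Fin.castLE hk m) * PuncturedSurfaceGroup.b (Fin.castLE hk m) *
                (PuncturedSurfaceGroup.a (Fin.castLE hk m))⁻¹) ∨
            (∃ i : Fin g, k ≤ (i : ℕ) ∧ (x = PuncturedSurfaceGroup.a i ∨ x = PuncturedSurfaceGroup.b i)) ∨
            ∃ j : Fin r, x = PuncturedSurfaceGroup.c j}).map ι).topologicalClosure ∧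
          G.genus v₀ = g - k) :
    ∀ ⦃Q : Type⦄ [Group Q] [TopologicalSpace Q] [IsTopologicalGroup Q] (G : PSCDatum Q),
      Ω.IsOfPSCType G → G.VerticialSeparatingCoverings ∧ G.VerticialOpenInterDeterminesVertex ∧
        ∀ A : Subgroup Q, G.IsVerticial A → Subgroup.Commensurable.commensurator A = A := by
  intro Q _ _ _ G hG
  obtain ⟨hc, -, hd, S, g, r, k, hk, ι, e, v₀, eN, hne, hprime, hι, -, hr, hkr, -, hV, -, hV₀, -⟩ := hΩ G hG
  exact G.verticialRows_of_irreducibleMultiNodal hne hprime ι hι hk hr hkr v₀ hV hV₀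

/-- **The same at every origin whose data are of irreducible ONE-nodal shape with `r ≥ 1`** (gen 2/4's
origin hypothesis of `PSCUnrVerticialSeparatingCoveringsIrreducibleNodal.lean` with `1 ≤ r` added).
[cite: MochizukiCombGC2007, Prop 1.2(ii) p.8] -/
theorem irreducibleNodalOrigin_verticialRows (Ω : PSCOrigin.{0})
    (hΩ : ∀ ⦃Q : Type⦄ [Group Q] [TopologicalSpace Q] [IsTopologicalGroup Q] (G : PSCDatum Q),
      Ω.IsOfPSCType G → CompactSpace Q ∧ T2Space Q ∧ TotallyDisconnectedSpace Q ∧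
        ∃ (S : Set ℕ) (g r : ℕ) (hg : 1 ≤ g) (ι : PuncturedSurfaceGroup g r →* Q) (e : G.graph.C ≃ Fin r)
          (v₀ : G.graph.V) (n₀ : G.graph.N),
          S.Nonempty ∧ (∀ p ∈ S, p.Prime) ∧ IsProSigmaCompletion S ι ∧ (2 ≤ g ∨ 2 ≤ r) ∧ 1 ≤ r ∧
          (∀ c, G.cuspGp c =
            ((PuncturedSurfaceGroup.cuspInertia (g := g) (e c)).map ι).topologicalClosure) ∧
          (∀ w, w = v₀) ∧ (∀ n, n = n₀) ∧
          G.nodeGp n₀ = ((Subgroup.zpowers (PuncturedSurfaceGroup.b (r := r) (⟨0, hg⟩ : Fin g))).map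
            ι).topologicalClosure ∧
          G.vertGp v₀ = ((Subgroup.closure {x : PuncturedSurfaceGroup g r |
            x = PuncturedSurfaceGroup.b ⟨0, hg⟩ ∨
            x = PuncturedSurfaceGroup.a ⟨0, hg⟩ * PuncturedSurfaceGroup.b ⟨0, hg⟩ * (PuncturedSurfaceGroup.a ⟨0, hg⟩)⁻¹ ∨
            (∃ i : Fin g, 1 ≤ (i : ℕ) ∧ (x = PuncturedSurfaceGroup.a i ∨ x = PuncturedSurfaceGroup.b i)) ∨
            ∃ j : Fin r, x = PuncturedSurfaceGroup.c j}).map ι).topologicalClosure ∧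
          G.genus v₀ = g - 1) :
    ∀ ⦃Q : Type⦄ [Group Q] [TopologicalSpace Q] [IsTopologicalGroup Q] (G : PSCDatum Q),
      Ω.IsOfPSCType G → G.VerticialSeparatingCoverings ∧ G.VerticialOpenInterDeterminesVertex ∧
        ∀ A : Subgroup Q, G.IsVerticial A → Subgroup.Commensurable.commensurator A = A := by
  intro Q _ _ _ G hG
  obtain ⟨hc, -, hd, S, g, r, hg, ι, e, v₀, n₀, hne, hprime, hι, hgr, hr, -, hV, -, -, hV₀, -⟩ := hΩ G hG
  exact G.verticialRows_of_irreducibleNodal hne hprime ι hι hg hr hgr v₀ hV hV₀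

end PSCDatum

end Literature.AnabelianGeometry.SemiGraphs

end
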